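import Summits.KontsevichZagierPeriods.KontsevichZagierPeriods.Theorems.HurwitzMicroSectorsNormalFormPrincipleM3KernelReduceHalfPoint
import Summits.KontsevichZagierPeriods.KontsevichZagierPeriods.Theorems.HurwitzMicroSectorsNormalFormPrincipleL2W3RelationsMoebiusTwo
import Summits.KontsevichZagierPeriods.KontsevichZagierPeriods.Theorems.HurwitzMicroSectorsNormalFormPrincipleM3WordsLogCube

/-!
# `NormalFormPrinciple` (stmt-KontsevichZagierPeriods-3869), line `SketchIdeator1` —
# M3 words-kernel capstone: the word reductions `ccb`, `ccc`, `cab`, `cac` (multiplier 24)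

Pure proof file (registered sub-goal `m3x_reduce_words_3` of the extended M3 kernel capstone, lead
seat c9; `--supports` the crux). The extended capstone reduces every word family
`[Δ, x(t₀)y(t₁)z(t₂)]` of the level-2 weight-3 descent, after multiplication by `24`, to
`α•[Z] + β•[Q] + γ•[B3]` modulo `KZ.relations`, where `Z` is any representation of
`[(0,1)³, 1/(1−xyz)]` (value `ζ(3)`), `Q` any representation of `[(0,1)³, 1/((1−xy)(1+z))]`
(value `ζ(2)·log 2`) and `B3` any representation of the log cube
`[(0,1)³, 1/((1+x)(1+y)(1+z))]` (value `(log 2)³`). This file treats the third package of words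
(letters `a(u) = 1/u`, `b(u) = 1/(1−u)`, `c(u) = 1/(1+u)` on the decreasing open simplex `Δ`):

* `ccb ↦ (3, 0, −4)`, `ccc ↦ (0, 0, 4)`, `cab ↦ (−15, 24, 0)`, `cac ↦ (−6, 12, 0)`.

Chain of moves: the simplex chart `(x, xy, xyz)` gives `[Z] = [aab]`; the prism chart `(x, xy, z)`
gives `[Q] = [P, ab ⊗ c]`; the log cube is six copies of `[ccc]` (`m3x_logCube_sub_six_ccc`); the
given carrier `W` is congruent to its twin among the sixteen landed word carriers (rule (1b)); and
the integer certificates over the landed relation packages (dilation `rel1`, `rel2`; Möbius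
`rel3`, `rel4`, `rel6`; reflection `rel5`; the shuffle `S1 : [P, ab ⊗ c] = [abc] + [acb] + [cab]`
and the shuffle relation `relS : 4[acc] + 2[cac] = [abc] + [acb] + [cab]`)

  `24[ccb] − 3[aab] + 24[ccc] = −3rel1 + 6rel2 + 12rel3 + 12rel4 − 18rel5 + 24rel6`,
  `24[cab] + 15[aab] − 24[P] = 3rel1 + 6rel2 − 12rel3 − 12rel4 + 6rel5 − 24·S1`,
  `24[cac] + 6[aab] − 12[P] = 6rel1 − 12rel2 − 24rel3 − 24rel4 + 36rel5 − 12·S1 + 12·relS`.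

Bookkeeping only; no independence input. References: M. Kontsevich, D. Zagier, *Periods* (2001),
§1.1–1.2 (rules (1), (2)). No definitions are introduced.
-/

noncomputable section

open MeasureTheory Set
open Literature.NumberTheory.Transcendental Literature.NumberTheory.Transcendental.KZ

namespace Summit.KontsevichZagierPeriods.HurwitzMicroSectors.NormalFormPrinciple.PiBox.M3

/-- **Stub (`m3x_reduce_words_3`; registered sub-goal of stmt-KontsevichZagierPeriods-3869,
line `SketchIdeator1`, extended M3 kernel capstone).** For any box representations `Z` of
`1/(1−xyz)`, `Q` of `1/((1−xy)(1+z))` and `B3` of `1/((1+x)(1+y)(1+z))`, every carrier `W` on the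
decreasing open simplex of each of the words `ccb`, `ccc`, `cab`, `cac` satisfies
`24•[W] − (α•[Z] + β•[Q] + γ•[B3]) ∈ KZ.relations` with
`(α, β, γ) = (3, 0, −4), (0, 0, 4), (−15, 24, 0), (−6, 12, 0)` respectively (one simplex chart, one
prism chart, the log-cube dissection, and integer certificates over the landed relation packages).
[cite: KontsevichZagier2001, §1.2 rules (1), (2)] -/
theorem m3x_reduce_words_3 :
    ∀ (Z Q B3 : IntegralRep 3),
      Z.domain = {x | ∀ i, x i ∈ Set.Ioo (0:ℝ) 1} → (Z.integrand = fun x => 1 / (1 - x 0 * x 1 * x 2)) →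
      Q.domain = {x | ∀ i, x i ∈ Set.Ioo (0:ℝ) 1} → EqOn Q.integrand (fun x => 1 / ((1 - x 0 * x 1) * (1 + x 2))) Q.domain →
      B3.domain = {x | ∀ i, x i ∈ Set.Ioo (0:ℝ) 1} → (B3.integrand = fun x => 1 / ((1 + x 0) * (1 + x 1) * (1 + x 2))) →
        (∀ W : IntegralRep 3, W.domain = {t | 0 < t 2 ∧ t 2 < t 1 ∧ t 1 < t 0 ∧ t 0 < 1} →
          EqOn W.integrand (fun t => 1 / (1 + t 0) * (1 / (1 + t 1)) * (1 / (1 - t 2))) W.domain →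
          (24:ℕ) • of W - ((3:ℤ) • of Z + (0:ℤ) • of Q + (-4:ℤ) • of B3) ∈ relations) ∧
        (∀ W : IntegralRep 3, W.domain = {t | 0 < t 2 ∧ t 2 < t 1 ∧ t 1 < t 0 ∧ t 0 < 1} →
          EqOn W.integrand (fun t => 1 / (1 + t 0) * (1 / (1 + t 1)) * (1 / (1 + t 2))) W.domain →
          (24:ℕ) • of W - ((0:ℤ) • of Z + (0:ℤ) • of Q + (4:ℤ) • of B3) ∈ relations) ∧
        (∀ W : IntegralRep 3, W.domain = {t | 0 < t 2 ∧ t 2 < t 1 ∧ t 1 < t 0 ∧ t 0 < 1} →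
          EqOn W.integrand (fun t => 1 / (1 + t 0) * 1 / t 1 * (1 / (1 - t 2))) W.domain →
          (24:ℕ) • of W - ((-15:ℤ) • of Z + (24:ℤ) • of Q + (0:ℤ) • of B3) ∈ relations) ∧
        (∀ W : IntegralRep 3, W.domain = {t | 0 < t 2 ∧ t 2 < t 1 ∧ t 1 < t 0 ∧ t 0 < 1} →
          EqOn W.integrand (fun t => 1 / (1 + t 0) * 1 / t 1 * (1 / (1 + t 2))) W.domain →
          (24:ℕ) • of W - ((-6:ℤ) • of Z + (12:ℤ) • of Q + (0:ℤ) • of B3) ∈ relations) := by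
  intro Z Q B3 hZd hZi hQd hQi hB3d hB3i
  -- (1) the word carriers on `Δ`
  obtain ⟨AAB, ABB, AAC, ACC, ABC, ACB, CBB, CBC, CCB, CCC, CAB, CAC, -, -, -, -,
    ⟨hAABd, hAABi⟩, ⟨hABBd, hABBi⟩, ⟨hAACd, hAACi⟩, ⟨hACCd, hACCi⟩, ⟨hABCd, hABCi⟩,
    ⟨hACBd, hACBi⟩, ⟨hCBBd, hCBBi⟩, ⟨hCBCd, hCBCi⟩, ⟨hCCBd, hCCBi⟩, ⟨hCCCd, hCCCi⟩,
    ⟨hCABd, hCABi⟩, ⟨hCACd, hCACi⟩, -, -, -, -⟩ := l2w3_carriers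
  -- (2) `[Z] = [aab]` by the simplex chart: `1/(1−xyz) = a(x)·a(xy)·b(xyz)·(x²y)`
  have eZ : of Z - of AAB ∈ relations := by
    refine ebd_box_sub_simplex (fun t => 1 / t 0 * 1 / t 1 * (1 / (1 - t 2))) Z AAB hZd hAABd
      (hAABi ▸ fun _ _ => rfl) fun x hx => ?_
    have hx' : ∀ i, x i ∈ Set.Ioo (0:ℝ) 1 := by rw [hZd] at hx; exact hx
    have h0 : x 0 ≠ 0 := (hx' 0).1.ne'
    have h1 : x 1 ≠ 0 := (hx' 1).1.ne'
    have h012m : 1 - x 0 * x 1 * x 2 ≠ 0 := by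
      have := mul_lt_one_of_nonneg_of_lt_one_left (mul_pos (hx' 0).1 (hx' 1).1).le
        (mul_lt_one_of_nonneg_of_lt_one_left (hx' 0).1.le (hx' 0).2 (hx' 1).2.le) (hx' 2).2.le
      exact (sub_pos.2 this).ne'
    rw [hZi]
    simp only [Matrix.cons_val_zero, Matrix.cons_val_one, Matrix.cons_val_two, Matrix.head_cons,
      Matrix.tail_cons]
    field_simp
  -- (3) `[Q] = [P, ab ⊗ c]` by the prism chart `(x, xy, z)`; the prism carriers (from `3•Q`)
  obtain ⟨hprism, hexP⟩ := l2w3_box_sub_prism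
  obtain ⟨⟨PABC, hPABCd, hPABCi⟩, ⟨PACC, hPACCd, hPACCi⟩⟩ :=
    hexP (Q.constMul ((3:ℕ) : ℝ) (isAlgebraic_nat 3))
      (by rw [IntegralRep.domain_constMul]; exact hQd) fun x hx => by
        rw [IntegralRep.domain_constMul] at hx
        simp only [IntegralRep.integrand_constMul, hQi hx]
        push_cast
        ring
  have eQ : of Q - of PABC ∈ relations := by
    refine hprism (fun t => 1 / t 0 * (1 / (1 - t 1)) * (1 / (1 + t 2))) Q PABC hQd hPABCd
      (hPABCi ▸ fun _ _ => rfl) fun x hx => ?_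
    have hx' : ∀ i, x i ∈ Set.Ioo (0:ℝ) 1 := by rw [hQd] at hx; exact hx
    have h0 : x 0 ≠ 0 := (hx' 0).1.ne'
    have h01 : 1 - x 0 * x 1 ≠ 0 :=
      (sub_pos.2 (mul_lt_one_of_nonneg_of_lt_one_left (hx' 0).1.le (hx' 0).2 (hx' 1).2.le)).ne'
    have h2 : 1 + x 2 ≠ 0 := by linarith [(hx' 2).1]
    rw [hQi hx]
    simp only [Matrix.cons_val_zero, Matrix.cons_val_one, Matrix.cons_val_two, Matrix.head_cons,
      Matrix.tail_cons]
    field_simp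
  -- (4) `[B3] = 6[ccc]`: the log-cube dissection (sibling sub-goal `m3x_logCube_sub_six_ccc`)
  have eB : of B3 - (6:ℤ) • of CCC ∈ relations :=
    m3x_logCube_sub_six_ccc B3 CCC hB3d (fun x _ => congrFun hB3i x) hCCCd hCCCi
  -- (5) the landed relation packages
  have rel1 : (3:ℤ) • of AAB - (4:ℤ) • of AAC ∈ relations :=
    l2w3_relations_dilation.1 AAB hAABd hAABi AAC hAACd hAACi
  have rel2 : of ABB - (2:ℤ) • of ABC - (2:ℤ) • of ACB + (2:ℤ) • of ACC ∈ relations :=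
    l2w3_relations_dilation.2 ABB hABBd hABBi ABC hABCd hABCi ACB hACBd hACBi ACC hACCd hACCi
  have rel3 : of CBB + of CBC + of CCB + of CCC - of AAC ∈ relations :=
    l2w3_relations_moebius_one.1 AAC hAACd hAACi CBB hCBBd hCBBi CBC hCBCd hCBCi CCB hCCBd hCCBi
      CCC hCCCd hCCCi
  have rel4 : of ABB + of ABC + of ACB + of ACC - of CBB - of CBC - of CCB - of CCC - of AAB ∈
      relations :=
    l2w3_relations_moebius_one.2 AAB hAABd hAABi ABB hABBd hABBi ABC hABCd hABCi ACB hACBd hACBi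
      ACC hACCd hACCi CBB hCBBd hCBBi CBC hCBCd hCBCi CCB hCCBd hCCBi CCC hCCCd hCCCi
  have rel5 : of ABB - of AAB ∈ relations :=
    l2w3_relations_reflection.1 AAB hAABd hAABi ABB hABBd hABBi
  have rel6 : of CCB + of CCC - of ACC ∈ relations :=
    l2w3_relations_moebius_two.1 ACC hACCd hACCi CCB hCCBd hCCBi CCC hCCCd hCCCi
  obtain ⟨shuf, relS⟩ := l2w3_relation_shuffle PABC PACC ABC ACB CAB ACC CAC hPABCd hPABCi
    hPACCd hPACCi hABCd hABCi hACBd hACBi hCABd hCABi hACCd hACCi hCACd hCACi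
  refine ⟨fun W hWd hWi => ?_, fun W hWd hWi => ?_, fun W hWd hWi => ?_, fun W hWd hWi => ?_⟩
  · -- the word `ccb`: `(α, β, γ) = (3, 0, −4)`; certificate
    --   `24[ccb] − 3[aab] + 24[ccc] = −3rel1 + 6rel2 + 12rel3 + 12rel4 − 18rel5 + 24rel6`
    have hW : of W - of CCB ∈ relations :=
      of_sub_of_mem_relations_of_eqOn (hCCBd.trans hWd.symm) fun t ht => by rw [hWi ht, hCCBi]
    have key : (24:ℤ) • of CCB - (3:ℤ) • of AAB + (24:ℤ) • of CCC =
        -((3:ℤ) • ((3:ℤ) • of AAB - (4:ℤ) • of AAC))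
        + (6:ℤ) • (of ABB - (2:ℤ) • of ABC - (2:ℤ) • of ACB + (2:ℤ) • of ACC)
        + (12:ℤ) • (of CBB + of CBC + of CCB + of CCC - of AAC)
        + (12:ℤ) • (of ABB + of ABC + of ACB + of ACC - of CBB - of CBC - of CCB - of CCC
          - of AAB)
        - (18:ℤ) • (of ABB - of AAB)
        + (24:ℤ) • (of CCB + of CCC - of ACC) := by
      abel
    have hmid : (24:ℤ) • of CCB - (3:ℤ) • of AAB + (24:ℤ) • of CCC ∈ relations := by
      rw [key]
      exact relations.add_mem (relations.sub_mem (relations.add_mem (relations.add_mem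
        (relations.add_mem (relations.neg_mem (relations.zsmul_mem rel1 3))
        (relations.zsmul_mem rel2 6)) (relations.zsmul_mem rel3 12)) (relations.zsmul_mem rel4 12))
        (relations.zsmul_mem rel5 18)) (relations.zsmul_mem rel6 24)
    have e : (24:ℕ) • of W - ((3:ℤ) • of Z + (0:ℤ) • of Q + (-4:ℤ) • of B3) =
        (24:ℤ) • (of W - of CCB)
        + ((24:ℤ) • of CCB - (3:ℤ) • of AAB + (24:ℤ) • of CCC)
        - (3:ℤ) • (of Z - of AAB) + (4:ℤ) • (of B3 - (6:ℤ) • of CCC) := by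
      abel
    rw [e]
    exact relations.add_mem (relations.sub_mem (relations.add_mem (relations.zsmul_mem hW 24) hmid)
      (relations.zsmul_mem eZ 3)) (relations.zsmul_mem eB 4)
  · -- the word `ccc`: `(α, β, γ) = (0, 0, 4)`;
    --   `24[W] − 4[B3] = 24([W] − [ccc]) − 4([B3] − 6[ccc])`
    have hW : of W - of CCC ∈ relations :=
      of_sub_of_mem_relations_of_eqOn (hCCCd.trans hWd.symm) fun t ht => by rw [hWi ht, hCCCi]
    have e : (24:ℕ) • of W - ((0:ℤ) • of Z + (0:ℤ) • of Q + (4:ℤ) • of B3) =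
        (24:ℤ) • (of W - of CCC) - (4:ℤ) • (of B3 - (6:ℤ) • of CCC) := by
      abel
    rw [e]
    exact relations.sub_mem (relations.zsmul_mem hW 24) (relations.zsmul_mem eB 4)
  · -- the word `cab`: `(α, β, γ) = (−15, 24, 0)`; certificate
    --   `24[cab] + 15[aab] − 24[P] = 3rel1 + 6rel2 − 12rel3 − 12rel4 + 6rel5 − 24·S1`
    have hW : of W - of CAB ∈ relations :=
      of_sub_of_mem_relations_of_eqOn (hCABd.trans hWd.symm) fun t ht => by rw [hWi ht, hCABi]
    have key : (24:ℤ) • of CAB + (15:ℤ) • of AAB - (24:ℤ) • of PABC =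
        (3:ℤ) • ((3:ℤ) • of AAB - (4:ℤ) • of AAC)
        + (6:ℤ) • (of ABB - (2:ℤ) • of ABC - (2:ℤ) • of ACB + (2:ℤ) • of ACC)
        - (12:ℤ) • (of CBB + of CBC + of CCB + of CCC - of AAC)
        - (12:ℤ) • (of ABB + of ABC + of ACB + of ACC - of CBB - of CBC - of CCB - of CCC
          - of AAB)
        + (6:ℤ) • (of ABB - of AAB)
        - (24:ℤ) • (of PABC - of ABC - of ACB - of CAB) := by
      abel
    have hmid : (24:ℤ) • of CAB + (15:ℤ) • of AAB - (24:ℤ) • of PABC ∈ relations := by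
      rw [key]
      exact relations.sub_mem (relations.add_mem (relations.sub_mem (relations.sub_mem
        (relations.add_mem (relations.zsmul_mem rel1 3) (relations.zsmul_mem rel2 6))
        (relations.zsmul_mem rel3 12)) (relations.zsmul_mem rel4 12)) (relations.zsmul_mem rel5 6))
        (relations.zsmul_mem shuf 24)
    have e : (24:ℕ) • of W - ((-15:ℤ) • of Z + (24:ℤ) • of Q + (0:ℤ) • of B3) =
        (24:ℤ) • (of W - of CAB)
        + ((24:ℤ) • of CAB + (15:ℤ) • of AAB - (24:ℤ) • of PABC)
        + (15:ℤ) • (of Z - of AAB) - (24:ℤ) • (of Q - of PABC) := by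
      abel
    rw [e]
    exact relations.sub_mem (relations.add_mem (relations.add_mem (relations.zsmul_mem hW 24) hmid)
      (relations.zsmul_mem eZ 15)) (relations.zsmul_mem eQ 24)
  · -- the word `cac`: `(α, β, γ) = (−6, 12, 0)`; certificate
    --   `24[cac] + 6[aab] − 12[P]
    --      = 6rel1 − 12rel2 − 24rel3 − 24rel4 + 36rel5 − 12·S1 + 12·relS`
    have hW : of W - of CAC ∈ relations :=
      of_sub_of_mem_relations_of_eqOn (hCACd.trans hWd.symm) fun t ht => by rw [hWi ht, hCACi]
    have key : (24:ℤ) • of CAC + (6:ℤ) • of AAB - (12:ℤ) • of PABC =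
        (6:ℤ) • ((3:ℤ) • of AAB - (4:ℤ) • of AAC)
        - (12:ℤ) • (of ABB - (2:ℤ) • of ABC - (2:ℤ) • of ACB + (2:ℤ) • of ACC)
        - (24:ℤ) • (of CBB + of CBC + of CCB + of CCC - of AAC)
        - (24:ℤ) • (of ABB + of ABC + of ACB + of ACC - of CBB - of CBC - of CCB - of CCC
          - of AAB)
        + (36:ℤ) • (of ABB - of AAB)
        - (12:ℤ) • (of PABC - of ABC - of ACB - of CAB)
        + (12:ℤ) • ((4:ℤ) • of ACC + (2:ℤ) • of CAC - of ABC - of ACB - of CAB) := by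
      abel
    have hmid : (24:ℤ) • of CAC + (6:ℤ) • of AAB - (12:ℤ) • of PABC ∈ relations := by
      rw [key]
      exact relations.add_mem (relations.sub_mem (relations.add_mem (relations.sub_mem
        (relations.sub_mem (relations.sub_mem (relations.zsmul_mem rel1 6)
        (relations.zsmul_mem rel2 12)) (relations.zsmul_mem rel3 24)) (relations.zsmul_mem rel4 24))
        (relations.zsmul_mem rel5 36)) (relations.zsmul_mem shuf 12)) (relations.zsmul_mem relS 12)
    have e : (24:ℕ) • of W - ((-6:ℤ) • of Z + (12:ℤ) • of Q + (0:ℤ) • of B3) =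
        (24:ℤ) • (of W - of CAC)
        + ((24:ℤ) • of CAC + (6:ℤ) • of AAB - (12:ℤ) • of PABC)
        + (6:ℤ) • (of Z - of AAB) - (12:ℤ) • (of Q - of PABC) := by
      abel
    rw [e]
    exact relations.sub_mem (relations.add_mem (relations.add_mem (relations.zsmul_mem hW 24) hmid)
      (relations.zsmul_mem eZ 6)) (relations.zsmul_mem eQ 12)

end Summit.KontsevichZagierPeriods.HurwitzMicroSectors.NormalFormPrinciple.PiBox.M3
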